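import Summits.BirchSwinnertonDyer.BirchSwinnertonDyer.Theorems.PrintCFramBottomClassIndexLawFiveLeBorelGrossSurjectivityLeaf
import Summits.BirchSwinnertonDyer.BirchSwinnertonDyer.Theorems.PrintCFramBottomClassIndexLawFiveLeBorelGrossSurjectivityTowerLeaf
import Literature.NumberTheory.EllipticCurves.HeegnerPointsKolyvaginPrimaryPairingProofs
import HarnessLib

/-!
# Route `PrintCFram`, crux C2 `BottomClassIndexLawFiveLe` (stmt-BirchSwinnertonDyer-20372), line
# `eisenstein-resource-bdp-line` (S2 `stub_kolyvaginUpper_borelCM_pairSum`, input (γ), next link):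
# **McCallum 1991, Prop. 3.1 / Cor. 3.2 from JOINT SURJECTIVITY alone** — the Galois element with
# prescribed `[xᵢ, ρ^τρ]`, image-free, at level `p` and at level `p^M`; and its Borel CM instance
# (cell `bsd-print-cfram`, seat `bsd-line-cfram-p1-w2` g5; helper `--supports` 20372; 0 facts, 0 defs)

HONEST FRAMING. Nothing about BSD is proved here, and nothing of S2 itself. In the tree's Kolyvagin
machine the image hypotheses `hS` (`E[p]` simple), `hC` (scalar commutant), `hz` (`−1 ∈ ρ̄(Γ_K)`)
and the independence of the classes enter McCallum's Prop. 3.1 / Cor. 3.2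
(`IsLiftOfAut.exists_h1Eval_conj_mul_eq_zero_iff`, `IsLiftOfAut.exists_h1Eval_conj_mul_order`)
ONLY through the joint surjectivity of the evaluations (`exists_h1Eval_eq`,
`exists_h1Eval_eq_of_indep`). This file re-proves both with that surjectivity as the HYPOTHESIS
(`…_of_jointSurj`: verbatim the tree's proofs after the first line), so that any source of
surjectivity can be plugged in — in particular the uniserial / `𝔭`-adic Prop. 9.3 of the class
(`exists_h1Eval_eq_of_cmRamified`, `exists_h1Eval_eq_pow_of_cmRamified`, files 8c/8e), which hold at
the Borel CM-ramified prime where `hS`, `hC`, `hz` all FAIL. The level-`p` Borel instance is spelled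
out (`exists_h1Eval_conj_mul_eq_zero_iff_of_cmRamified`: classes independent modulo `W[𝔭]`), and so
is the level-`p^M` one (`exists_h1Eval_conj_mul_order_of_cmRamified`: classes killed by `p^{eᵢ}`,
i.e. by `𝔭^{2eᵢ}`, whose top-layer functionals `∑ cᵢ μ^{2eᵢ−1}[xᵢ, ·]` are independent; the
`𝔭`-adic END STATE `exists_h1Eval_eq_pow_of_cmRamified` with exponents `2eᵢ`, `ker μ^{2e} = W[p^e]`).
What is still the tree's, image-free: the `τ`-eigenvectors `e_±` (`RatClosure.exists_eigenvectors`,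
Weil pairing), `2` invertible (`p` odd), Čebotarev. THEOREMS ONLY; no definition, no named fact, no
`sorry`. BSD is not proved by any of this; no summit statement is proved by this seat.
References: [McCallumLMS1991] §3 Prop. 3.1, Cor. 3.2; [GrossLMS1991] §9.
-/

set_option autoImplicit false
-- `…BirchSwinnertonDyer.BirchSwinnertonDyer.Theorems…` is the problem's mandated namespace (D-0017).
set_option linter.dupNamespace false

noncomputable section

open scoped Classical

namespace Summit.BirchSwinnertonDyer.BirchSwinnertonDyer.Theorems.PrintCFram.BorelKolyvaginPairing

open WeierstrassCurve Field Literature.NumberTheory.EllipticCurves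
  Literature.NumberTheory.EllipticCurves.KolyvaginPairing Literature.NumberTheory.GaloisRepresentations
  Literature.NumberTheory.EllipticCurves.Rank1Residual

universe u v

/-! ## §1 McCallum Prop. 3.1 / Cor. 3.2 from joint surjectivity (any field, any curve) -/

section Conj

variable {k : Type v} {K : Type u} [Field k] [Field K] [Algebra k K] (W : WeierstrassCurve k)
variable {σ : K ≃ₐ[k] K} {τ : AlgebraicClosure K ≃+* AlgebraicClosure K}

/-- **McCallum 1991, Prop. 3.1 — from joint surjectivity (level `p`).** For an involutive lift `τ`
of `σ` with eigenvectors `e₊, e₋ ≠ 0` of both signs on `E[p]`, `2` invertible on `E[p]`,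
`σ`-eigenclasses `x_i` (`σ_* x_i = ν_i x_i`), `N_i ∈ {0, 1}`, and ASSUMING the evaluations
`ρ ↦ ([x_i, ρ])_i` are jointly surjective onto `E[p]^r` (`hsurj` — from `exists_h1Eval_eq` in the
`GL₂` case, from `exists_h1Eval_eq_of_cmRamified` at a Borel CM prime): there is
`ρ ∈ Γ_{K(E[p])}` such that for every `m ∈ 𝒩`, `F = (τ⁻¹ρmτ)(ρm)` has `[x_i, F] = 0 ⟺ N_i = 0`.
The tree's proof, verbatim after its first line. [cite: McCallumLMS1991, Prop. 3.1 and Cor. 3.2 (proofs)] -/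
theorem exists_h1Eval_conj_mul_eq_zero_iff_of_jointSurj (hτ : IsLiftOfAut σ τ)
    (hinv : ∀ x, τ (τ x) = x) {p : ℕ}
    {u : ℤ} (hu : ∀ P : geomTorsion (W.baseChange K) p, (2 * u) • P = P)
    {ePlus eMinus : geomTorsion (W.baseChange K) p} (hePlus : hτ.torsionMap W p ePlus = ePlus)
    (heMinus : hτ.torsionMap W p eMinus = -eMinus) (hPlus0 : ePlus ≠ 0) (hMinus0 : eMinus ≠ 0)
    {r : ℕ} {xs : Fin r → galH1Torsion (W.baseChange K) p} {ν : Fin r → ℤ}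
    (hν : ∀ i, ν i = 1 ∨ ν i = -1) (hxs : ∀ i, conjAct W σ p (xs i) = ν i • xs i)
    (Nv : Fin r → ℕ) (hN : ∀ i, Nv i ≤ 1)
    (hsurj : ∀ e : Fin r → geomTorsion (W.baseChange K) p,
      ∃ ρ ∈ torsionFixing (W.baseChange K) p, ∀ i, h1Eval (W.baseChange K) p (xs i) ρ = e i) :
    ∃ ρ ∈ torsionFixing (W.baseChange K) p, ∀ m ∈ evalKer (W.baseChange K) p xs, ∀ i,
      h1Eval (W.baseChange K) p (xs i) (hτ.conjGalCMH (ρ * m) * (ρ * m)) = 0 ↔ Nv i = 0 := by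
  -- target values
  set e : Fin r → geomTorsion (W.baseChange K) p :=
    fun i ↦ if Nv i = 0 then 0 else if ν i = 1 then ePlus else eMinus with he
  obtain ⟨ρ, hρ, hρe⟩ := hsurj e
  refine ⟨ρ, hρ, fun m hm i ↦ ?_⟩
  have hρm : ρ * m ∈ torsionFixing (W.baseChange K) p := mul_mem hρ hm.1
  have hval : h1Eval (W.baseChange K) p (xs i) (hτ.conjGalCMH (ρ * m) * (ρ * m)) =
      ν i • hτ.torsionMap W p (e i) + e i := by
    rw [h1Eval_mul _ _ _ (hτ.conjGalCMH_mem_torsionFixing W hinv _ hρm),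
      hτ.h1Eval_conjGalCMH_of_eigen W hinv _ (hν i) (hxs i) hρm, h1Eval_mul _ _ _ hρ, hρe i,
      hm.2 i, add_zero]
  rw [hval]
  have hNi : Nv i = 0 ∨ Nv i = 1 := by have := hN i; omega
  rcases hNi with h0 | h1
  · simp [he, h0]
  · have hne : ν i • hτ.torsionMap W p (e i) + e i ≠ 0 := by
      rcases hν i with h | h
      · have : e i = ePlus := by simp [he, h1, h]
        rw [this, h, hePlus, one_smul, ← two_zsmul]
        exact two_zsmul_ne_zero hu hPlus0
      · have : e i = eMinus := by simp [he, h1, h]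
        rw [this, h, heMinus, neg_smul, one_smul, neg_neg, ← two_zsmul]
        exact two_zsmul_ne_zero hu hMinus0
    simp [hne, h1]

/-- **McCallum 1991, Prop. 3.1 / Cor. 3.2 — from joint surjectivity (level `p^M`).** Involutive lift
`τ` of `σ` with eigenvectors `e_±` of order divisible by `p^M` (`p^{M-1} e_± ≠ 0`, `p^M e_± = 0`) in
`E[n]`, `2` invertible on `E[n]`, `σ`-eigenclasses `x_i ∈ H¹(K, E[n])`, exponents
`N_i ≤ min(e_i, M)`, and ASSUMING every `t` with `p^{eᵢ} tᵢ = 0` is a joint evaluation (`hsurj` —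
from `exists_h1Eval_eq_of_indep` in the `GL₂` case, from the `𝔭`-adic `exists_h1Eval_eq_pow_of_cmRamified`
at a Borel CM prime with `ker μ^{2e} = E[p^e]`): there is `ρ ∈ Γ_{K(E[n])}` such that for every
`m ∈ 𝒩` the element `F = (τ⁻¹ρmτ)(ρm)` has `p^{N_i}[x_i, F] = 0` and `p^{N_i−1}[x_i, F] ≠ 0`
(`N_i ≥ 1`). The tree's proof, verbatim after the choice of `ρ`. [cite: McCallumLMS1991, Prop. 3.1 and Cor. 3.2 (proofs)] -/
theorem exists_h1Eval_conj_mul_order_of_jointSurj (hτ : IsLiftOfAut σ τ)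
    (hinv : ∀ x, τ (τ x) = x) {p : ℕ} {n : ℤ} {M : ℕ}
    {u : ℤ} (hu : ∀ P : geomTorsion (W.baseChange K) n, (2 * u) • P = P)
    {ePlus eMinus : geomTorsion (W.baseChange K) n} (hePlus : hτ.torsionMap W n ePlus = ePlus)
    (heMinus : hτ.torsionMap W n eMinus = -eMinus)
    (hPlusM : ((p : ℤ) ^ M) • ePlus = 0) (hMinusM : ((p : ℤ) ^ M) • eMinus = 0)
    (hPlus0 : ((p : ℤ) ^ (M - 1)) • ePlus ≠ 0) (hMinus0 : ((p : ℤ) ^ (M - 1)) • eMinus ≠ 0)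
    {ι : Type*} [Fintype ι] {xs : ι → galH1Torsion (W.baseChange K) n} {ν : ι → ℤ}
    (hν : ∀ i, ν i = 1 ∨ ν i = -1) (hxs : ∀ i, conjAct W σ n (xs i) = ν i • xs i)
    (e : ι → ℕ) (Nv : ι → ℕ) (hNe : ∀ i, Nv i ≤ e i) (hNM : ∀ i, Nv i ≤ M)
    (hsurj : ∀ t : ι → geomTorsion (W.baseChange K) n, (∀ i, ((p : ℤ) ^ e i) • t i = 0) →
      ∃ ρ ∈ torsionFixing (W.baseChange K) n, ∀ i, h1Eval (W.baseChange K) n (xs i) ρ = t i) :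
    ∃ ρ ∈ torsionFixing (W.baseChange K) n, ∀ m ∈ evalKer (W.baseChange K) n xs, ∀ i,
      ((p : ℤ) ^ Nv i) • h1Eval (W.baseChange K) n (xs i) (hτ.conjGalCMH (ρ * m) * (ρ * m)) = 0 ∧
      (Nv i ≠ 0 →
        ((p : ℤ) ^ (Nv i - 1)) • h1Eval (W.baseChange K) n (xs i) (hτ.conjGalCMH (ρ * m) * (ρ * m))
          ≠ 0) := by
  -- target values `t_i = p^{M - N_i} e_{ν_i}`
  set ev : ι → geomTorsion (W.baseChange K) n := fun i ↦ if ν i = 1 then ePlus else eMinus with hev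
  have hevτ : ∀ i, hτ.torsionMap W n (ev i) = ν i • ev i := fun i ↦ by
    rcases hν i with h | h
    · simp [hev, h, hePlus]
    · simp [hev, h, heMinus]
  have hevM : ∀ i, ((p : ℤ) ^ M) • ev i = 0 := fun i ↦ by
    by_cases h : ν i = 1 <;> simp [hev, h, hPlusM, hMinusM]
  have hev0 : ∀ i, ((p : ℤ) ^ (M - 1)) • ev i ≠ 0 := fun i ↦ by
    by_cases h : ν i = 1 <;> simp [hev, h, hPlus0, hMinus0]
  set t : ι → geomTorsion (W.baseChange K) n := fun i ↦ ((p : ℤ) ^ (M - Nv i)) • ev i with htdef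
  have ht : ∀ i, ((p : ℤ) ^ e i) • t i = 0 := fun i ↦ by
    simp only [htdef]
    rw [smul_smul, ← pow_add]
    have : e i + (M - Nv i) = (e i - Nv i) + M := by have := hNe i; have := hNM i; omega
    rw [this, pow_add, mul_smul, hevM, smul_zero]
  obtain ⟨ρ, hρ, hρe⟩ := hsurj t ht
  refine ⟨ρ, hρ, fun m hm i ↦ ?_⟩
  have hρm : ρ * m ∈ torsionFixing (W.baseChange K) n := mul_mem hρ hm.1
  have hνν : ν i * ν i = 1 := by rcases hν i with h | h <;> simp [h]
  have hval : h1Eval (W.baseChange K) n (xs i) (hτ.conjGalCMH (ρ * m) * (ρ * m)) = (2 : ℤ) • t i := by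
    rw [h1Eval_mul _ _ _ (hτ.conjGalCMH_mem_torsionFixing W hinv _ hρm),
      hτ.h1Eval_conjGalCMH_of_eigen W hinv _ (hν i) (hxs i) hρm, h1Eval_mul _ _ _ hρ, hρe i,
      hm.2 i, add_zero]
    simp only [htdef]
    rw [map_zsmul, hevτ, smul_smul, smul_smul, mul_comm (ν i), mul_assoc, hνν, mul_one, two_smul]
  have hA : ((p : ℤ) ^ Nv i) • t i = 0 := by
    simp only [htdef]
    rw [smul_smul, ← pow_add, Nat.add_sub_cancel' (hNM i), hevM]
  have hB : Nv i ≠ 0 → ((p : ℤ) ^ (Nv i - 1)) • t i ≠ 0 := fun hN ↦ by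
    simp only [htdef]
    rw [smul_smul, ← pow_add]
    have : Nv i - 1 + (M - Nv i) = M - 1 := by have := hNM i; omega
    rw [this]
    exact hev0 i
  rw [hval]
  constructor
  · rw [smul_comm ((p : ℤ) ^ Nv i) (2 : ℤ) (t i), hA, smul_zero]
  · intro hN h0
    rw [smul_comm ((p : ℤ) ^ (Nv i - 1)) (2 : ℤ) (t i)] at h0
    exact two_zsmul_ne_zero hu (hB hN) h0

end Conj

/-! ## §2 The Borel CM instance at level `p` -/

section Leaf

variable (W : WeierstrassCurve ℚ) [W.IsElliptic] (p : ℕ) [hp : Fact p.Prime]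
variable (K : Type) [Field K] [NumberField K]
variable {σ : K ≃ₐ[ℚ] K} {τ : AlgebraicClosure K ≃+* AlgebraicClosure K}

/-- **McCallum Prop. 3.1 on the Borel CM leaf (level `p`).** `W/ℚ` CM, `p ≥ 5` CM-ramified,
`μ = √−p` with its sign rule (`exists_sqrt_end_of_cmRamified`), `K` a number field of degree `< p`,
`τ` an involutive lift of `σ ∈ Aut(K/ℚ)` with eigenvectors `e_± ≠ 0` on `W(K̄)[p]`; for
`σ`-eigenclasses `x_i ∈ H¹(K, W[p])` whose evaluations are independent MODULO `W[𝔭]`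
(`μ(θ⁻¹ ∑ aᵢ[xᵢ, ρ]) = 0 ∀ρ ⟹ p ∣ aᵢ`) and `N_i ∈ {0, 1}` there is `ρ ∈ Γ_{K(W[p])}` with
`[x_i, (τ⁻¹ρmτ)(ρm)] = 0 ⟺ N_i = 0` for all `m ∈ 𝒩`. (`hS`, `hC`, `hz` of the tree's version are
false here; they are not needed.) [cite: McCallumLMS1991, Prop. 3.1] [cite: GrossLMS1991, Prop. 9.3] -/
theorem exists_h1Eval_conj_mul_eq_zero_iff_of_cmRamified (hCM : W.HasCM) (h5 : 5 ≤ p)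
    (hram : CMRamified W p) {s : AlgebraicClosure ℚ} {μ : AddMonoid.End W.geomPoints} {m : ℤ}
    (hs : s ^ 2 = ((-(p : ℤ) : ℤ) : AlgebraicClosure ℚ)) (hm : m.natAbs = p)
    (hμμ : ∀ P, μ (μ P) = m • P) (hcomm : ∀ g : absoluteGaloisGroup ℚ, g • s = s → ∀ P, μ (g • P) = g • μ P)
    (hanti : ∀ g : absoluteGaloisGroup ℚ, g • s = -s → ∀ P, μ (g • P) = -(g • μ P))
    (hK : Module.finrank ℚ K < p) (hτ : IsLiftOfAut σ τ) (hinv : ∀ x, τ (τ x) = x)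
    {u : ℤ} (hu : ∀ P : geomTorsion (W.baseChange K) p, (2 * u) • P = P)
    {ePlus eMinus : geomTorsion (W.baseChange K) p} (hePlus : hτ.torsionMap W p ePlus = ePlus)
    (heMinus : hτ.torsionMap W p eMinus = -eMinus) (hPlus0 : ePlus ≠ 0) (hMinus0 : eMinus ≠ 0)
    {r : ℕ} {xs : Fin r → galH1Torsion (W.baseChange K) p} {ν : Fin r → ℤ}
    (hν : ∀ i, ν i = 1 ∨ ν i = -1) (hxs : ∀ i, conjAct W σ p (xs i) = ν i • xs i)
    (Nv : Fin r → ℕ) (hN : ∀ i, Nv i ≤ 1)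
    (hind : ∀ a : Fin r → ℤ,
      (∀ ρ ∈ torsionFixing (W.baseChange K) (p : ℤ),
        μ ((RatClosure.torsionEquiv (K := K) W (p : ℤ)).symm
          (∑ i, a i • h1Eval (W.baseChange K) (p : ℤ) (xs i) ρ) : W.geomTorsion (p : ℤ)) = 0) →
        ∀ i, (p : ℤ) ∣ a i) :
    ∃ ρ ∈ torsionFixing (W.baseChange K) p, ∀ m ∈ evalKer (W.baseChange K) p xs, ∀ i,
      h1Eval (W.baseChange K) p (xs i) (hτ.conjGalCMH (ρ * m) * (ρ * m)) = 0 ↔ Nv i = 0 :=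
  exists_h1Eval_conj_mul_eq_zero_iff_of_jointSurj W hτ hinv hu hePlus heMinus hPlus0 hMinus0 hν hxs
    Nv hN (exists_h1Eval_eq_of_cmRamified W p K hCM h5 hram hs hm hμμ hcomm hanti hK xs hind)

end Leaf

/-! ## §3 The Borel CM instance at level `p^M` -/

section LeafPow

variable (W : WeierstrassCurve ℚ) [W.IsElliptic] (p : ℕ) [hp : Fact p.Prime]
variable (K : Type) [Field K] [NumberField K]
variable {σ : K ≃ₐ[ℚ] K} {τ : AlgebraicClosure K ≃+* AlgebraicClosure K}

omit [W.IsElliptic] hp in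
/-- `μ^{2k} = m^k` on `W(ℚ̄)` (`μ ∘ μ = m`). [folklore] -/
theorem pow_two_mul_apply {μ : AddMonoid.End W.geomPoints} {m : ℤ} (hμμ : ∀ P, μ (μ P) = m • P)
    (k : ℕ) (X : W.geomPoints) : (μ ^ (2 * k)) X = (m ^ k) • X := by
  induction k with
  | zero => simp
  | succ k ih =>
    rw [Nat.mul_succ, pow_succ_apply, pow_succ_apply, ih, map_zsmul, map_zsmul, hμμ, smul_smul,
      pow_succ]

omit [W.IsElliptic] hp in
/-- `p^e x = 0 ⟹ m^e x = 0` for `|m| = p`. [folklore] -/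
theorem pow_zsmul_eq_zero_of_natAbs_eq {A : Type*} [AddCommGroup A] {m : ℤ} (hm : m.natAbs = p)
    {e : ℕ} {x : A} (hx : ((p : ℤ) ^ e) • x = 0) : (m ^ e) • x = 0 := by
  rcases Int.natAbs_eq m with h | h
  · rw [h, hm, hx]
  · rw [h, hm, neg_pow, mul_smul, hx, smul_zero]

/-- **McCallum Prop. 3.1 / Cor. 3.2 on the Borel CM leaf (level `p^M`).** `W/ℚ` CM, `p ≥ 5`
CM-ramified, `μ = √−p` commuting with the `√−p`-fixing Galois elements, `K` a number field of degree
`< p`, `M ≥ 1`, `θ = RatClosure.torsionEquiv W (p^M)`, `τ` an involutive lift of `σ ∈ Aut(K/ℚ)` with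
eigenvectors `e_±` of order divisible by `p^M`, `2` invertible; `σ`-eigenclasses `xᵢ ∈ H¹(K, W[p^M])`
killed by `p^{eᵢ}` (= by `𝔭^{2eᵢ}`) whose TOP-LAYER functionals are independent —
`∑ cᵢ μ^{2eᵢ−1}(θ⁻¹[xᵢ, ρ]) = 0 ∀ ρ ∈ Γ_{K(W[p^M])} ⟹ p ∣ cᵢ` (`eᵢ > 0`); exponents
`Nᵢ ≤ min(eᵢ, M)`. Then some `ρ ∈ Γ_{K(W[p^M])}` has, for every `m ∈ 𝒩`, `ord [xᵢ, (τ⁻¹ρmτ)(ρm)] = p^{Nᵢ}`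
exactly. The tree's `IsLiftOfAut.exists_h1Eval_conj_mul_order` needs `E[p]` simple with scalar
commutant and `−1 ∈ ρ̄(Γ_K)` — all false here. [cite: McCallumLMS1991, Prop. 3.1 and Cor. 3.2]
[cite: GrossLMS1991, Prop. 9.3] -/
theorem exists_h1Eval_conj_mul_order_of_cmRamified (hCM : W.HasCM) (h5 : 5 ≤ p)
    (hram : CMRamified W p) {s : AlgebraicClosure ℚ} {μ : AddMonoid.End W.geomPoints} {m : ℤ}
    (hs : s ^ 2 = ((-(p : ℤ) : ℤ) : AlgebraicClosure ℚ)) (hm : m.natAbs = p)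
    (hμμ : ∀ P, μ (μ P) = m • P) (hcomm : ∀ g : absoluteGaloisGroup ℚ, g • s = s → ∀ P, μ (g • P) = g • μ P)
    (hK : Module.finrank ℚ K < p) {M : ℕ} (hM : 1 ≤ M) (hτ : IsLiftOfAut σ τ) (hinv : ∀ x, τ (τ x) = x)
    {u : ℤ} (hu : ∀ P : geomTorsion (W.baseChange K) ((p ^ M : ℕ) : ℤ), (2 * u) • P = P)
    {ePlus eMinus : geomTorsion (W.baseChange K) ((p ^ M : ℕ) : ℤ)}
    (hePlus : hτ.torsionMap W _ ePlus = ePlus) (heMinus : hτ.torsionMap W _ eMinus = -eMinus)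
    (hPlusM : ((p : ℤ) ^ M) • ePlus = 0) (hMinusM : ((p : ℤ) ^ M) • eMinus = 0)
    (hPlus0 : ((p : ℤ) ^ (M - 1)) • ePlus ≠ 0) (hMinus0 : ((p : ℤ) ^ (M - 1)) • eMinus ≠ 0)
    {ι : Type*} [Fintype ι] {xs : ι → galH1Torsion (W.baseChange K) ((p ^ M : ℕ) : ℤ)} {ν : ι → ℤ}
    (hν : ∀ i, ν i = 1 ∨ ν i = -1) (hxs : ∀ i, conjAct W σ _ (xs i) = ν i • xs i)
    (e : ι → ℕ) (he : ∀ i, ((p : ℤ) ^ e i) • xs i = 0)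
    (hind : ∀ c : ι → ℤ,
      (∀ ρ ∈ torsionFixing (W.baseChange K) ((p ^ M : ℕ) : ℤ),
        ∑ i, c i • (μ ^ (2 * e i - 1)) ((RatClosure.torsionEquiv (K := K) W ((p ^ M : ℕ) : ℤ)).symm
          (h1Eval (W.baseChange K) ((p ^ M : ℕ) : ℤ) (xs i) ρ) : W.geomPoints) = 0) →
        ∀ i, 0 < e i → (p : ℤ) ∣ c i)
    (Nv : ι → ℕ) (hNe : ∀ i, Nv i ≤ e i) (hNM : ∀ i, Nv i ≤ M) :
    ∃ ρ ∈ torsionFixing (W.baseChange K) ((p ^ M : ℕ) : ℤ),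
      ∀ m' ∈ evalKer (W.baseChange K) ((p ^ M : ℕ) : ℤ) xs, ∀ i,
        ((p : ℤ) ^ Nv i) • h1Eval (W.baseChange K) _ (xs i) (hτ.conjGalCMH (ρ * m') * (ρ * m')) = 0 ∧
        (Nv i ≠ 0 → ((p : ℤ) ^ (Nv i - 1)) •
          h1Eval (W.baseChange K) _ (xs i) (hτ.conjGalCMH (ρ * m') * (ρ * m')) ≠ 0) := by
  set θ := RatClosure.torsionEquiv (K := K) W ((p ^ M : ℕ) : ℤ) with hθ
  -- `μ^{2e} (θ⁻¹ y) = 0` whenever `p^e y = 0`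
  have hkill : ∀ (k : ℕ) (y : geomTorsion (W.baseChange K) ((p ^ M : ℕ) : ℤ)),
      ((p : ℤ) ^ k) • y = 0 → (μ ^ (2 * k)) ((θ.symm y : W.geomTorsion ((p ^ M : ℕ) : ℤ)) : W.geomPoints) = 0 := by
    intro k y hy
    rw [pow_two_mul_apply W hμμ, ← AddSubgroupClass.coe_zsmul, ← map_zsmul,
      pow_zsmul_eq_zero_of_natAbs_eq p hm hy, map_zero, ZeroMemClass.coe_zero]
  refine exists_h1Eval_conj_mul_order_of_jointSurj W hτ hinv hu hePlus heMinus hPlusM hMinusM hPlus0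
    hMinus0 hν hxs e Nv hNe hNM fun t ht => ?_
  refine exists_h1Eval_eq_pow_of_cmRamified W p K hCM h5 hram hs hm hμμ hcomm hK hM xs
    (fun i => 2 * e i) (fun i ρ hρ => hkill (e i) _ ?_) (fun c hc i hi => hind c hc i (by omega)) t
    (fun i => hkill (e i) (t i) (ht i))
  rw [← h1Eval_zsmul _ _ _ _ hρ, he i, h1Eval_zero _ _ hρ]

end LeafPow

end Summit.BirchSwinnertonDyer.BirchSwinnertonDyer.Theorems.PrintCFram.BorelKolyvaginPairing

end
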